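import Summits.KontsevichZagierPeriods.Zeta5Search.Barrier.ConeGammaTranslateChamberWeights
import Summits.KontsevichZagierPeriods.Zeta5Search.Barrier.ConeGammaTranslateTilt

/-!
# ζ(5) search — BARRIER: THE FIRST MOMENTS ON THE COHERENT CHAMBER — the drift's closed-orbit limit: `m_k(δ)` is chamber-wise
# AFFINE in the translate, with slope `−W_k` along its own rate and the junction first moment `M_k` as constant (file (3) of
# «THE CLOSED-ORBIT LIMIT»)

HONEST FRAMING (cell `pub-zeta5`): systematic search; no irrationality claim unless kernel-certified. MODEL objects
under Brown–Zudilin's (28)+(30) accounting ([BZ22] = arXiv:2210.03391; (28) observed, not proved); nothing here is a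
statement about `ζ(5)`, any `γ` of record, the cone's supremum (C2 OPEN) or the value / sign of any jump mass, first moment,
chamber weight or drift at a named direction (DATA of the cell); NO cancellation is quantified; S-E / (TD_A) stay CONJECTURED;
records in print UNMOVED. Prover P2 g41 (item «THE CLOSED-ORBIT LIMIT», file (3): P2 g40's successor menu (c) «the deviation of
`m_k` from its flow average» READ NEAR THE CLOSED ORBIT; plan INBOX 2026-08-28). Sources: P2 g40 `ConeGammaTranslateTilt` (THE TILT
THEOREM: `∫₀ᵀ[𝒩(u·(s(a)+η)+δ) − 𝒩(u·s(a)+δ)]du = Σ_k (φ_kη/(h_k+φ_kη))·m_k(δ)` with the FIRST MOMENTS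
`m_k(δ) = Σ_{z∈S_k} s_{k,z}·J_{k,z}` of the jumps of the translated orbit — lead/lit g27 `SE-DESK-NOTE.md` §3(ii)'s within-period
drift), files (1)–(2) `ConeGammaTranslateJunctions` / `ConeGammaTranslateChamberWeights` (on the coherent chamber every jump
`J_{k,z}` is the canonical marginal `g_k(b) = patternN a b (P≤(k)) − patternN a b (P<(k))` of the junction `b = z/h_k(a)` of the CLOSED
orbit, and `J_k(δ) = W_k(δ) = Σ_m g_k(b_m)`).

With the SETTING of files (1)–(2) (all 28 forms positive, `T > 0` a period, a translate `δ` with a margin `r` and coherence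
`|ρ_k| ≤ ρ̄`, `(2ρ̄ + r/2)·x_max < min(1, wallDist a T)`; `ρ_k = φ_k(δ)/h_k(a)`; `F` the canonical period pattern function):
* `sum_Ioc_floor_weighted_eq` — the crossing window `(⌊φ_kδ⌋, ⌊φ_kδ⌋ + N_k]` against `[0, N_k)` WITH the crossing times as
  weights: the two windows differ by the lattice junction's crossing, which sits at the START of the period (`s = −ρ_k`) when
  `ρ_k < 0` and at its END (`s = T − ρ_k`) when `ρ_k > 0` — a difference of `T·g_k(0)`;
* `patternN_marginal_eq_zero_of_nonmember` — at a junction of which `k` is not a member the marginal `g_k` vanishes;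
* **`firstMoment_eq_canonical` — THE FIRST MOMENTS ON THE COHERENT CHAMBER**: for EVERY form `k`,
  **`m_k(δ) = M_k − ρ_k·W_k + T·[ρ_k > 0]·g_k(0)`**, where **`M_k = Σ_{m<#bkpts−1} b_m·g_k(b_m)`** is the FIRST MOMENT OF THE CANONICAL
  MARGINALS over the junctions of one period, `W_k = F(P≤(k)) − F(P<(k))` the chamber weight and `g_k(0)` the marginal at the lattice
  junction (universal in the direction, P2 g33's `patternN_zero_eq`) — all three CHAMBER DATA of the closed orbit: on each open
  chamber of the rate arrangement inside the coherence ball the first moment is an explicit AFFINE function of the translate, with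
  slope `−W_k` along its own rate `ρ_k` and no dependence on the other rates;
* **`integral_tilt_sub_eq_canonical` — THE DRIFT'S CLOSED-ORBIT LIMIT**: for a tilt `η` with `T·|φ_kη| ≤ r·h_k/4`,
  `∫₀ᵀ[𝒩(u·(s(a)+η)+δ) − 𝒩(u·s(a)+δ)]du = Σ_k (φ_kη/(h_k+φ_kη))·(M_k − ρ_k·W_k + T·[ρ_k > 0]·g_k(0))` — SE-DESK-NOTE §3(ii)'s
  within-period drift at a coherent translate is an explicit expression in the closed orbit's junction data (the `k ≤ K` range of
  the desk note's drift sum, where Lemma B is exact, is thereby explicit term by term; its SIZE at a named direction is DATA).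
* `jumpMass_firstMoment_eq_canonical_of_coherent` — margin-free packaging of files (2)–(3): at a translate with pairwise distinct
  non-zero rates, `3ρ̄·x_max < min(1, wallDist a T)` and `2T·x_max²·ρ̄ < 1`, SOME margin `r ≤ 2ρ̄` realises `J_k = W_k` and the
  first-moment formula for every `k` (file (2)'s `exists_margin_of_coherent`).
NOT here (honest): any value of `m_k`, `M_k`, `W_k`, `g_k(0)` or of the drift at a named direction (DATA); the drift beyond the
coherence ball; any cancellation; `Φ`, `γ`, C2, S-E's truth, `ζ(5)`.
-/

noncomputable section

open Set MeasureTheory Finset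
open scoped Topology

namespace Summit.KontsevichZagierPeriods.Zeta5Search.Barrier.ConeGamma

/-! ### Bookkeeping with the crossing times as weights -/

/-- **The weighted crossing window.** For `|c| < 1`, `c ≠ 0`, `0 ≤ N`, `x ≠ 0` and `G(N) = G(0)`:
`Σ_{z ∈ (⌊c⌋, ⌊c⌋+N]} (z/x − ρ)·G(z) = Σ_{z∈[0,N)} (z/x)·G(z) − ρ·Σ_{z∈[0,N)} G(z) + [0 < c]·(N/x)·G(0)` (for `c > 0` the windows
`(0, N]` and `[0, N)` differ by the endpoints, whose weights differ by `N/x`; for `c < 0` they coincide). -/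
theorem sum_Ioc_floor_weighted_eq {c : ℝ} (hc1 : |c| < 1) (hc0 : c ≠ 0) {N : ℤ} (hN : 0 ≤ N) (x ρ : ℝ) (G : ℤ → ℝ)
    (hG : G N = G 0) :
    ∑ z ∈ Finset.Ioc ⌊c⌋ (⌊c⌋ + N), ((z : ℝ) / x - ρ) * G z =
      ∑ z ∈ Finset.Ico 0 N, (z : ℝ) / x * G z - ρ * ∑ z ∈ Finset.Ico 0 N, G z +
        if 0 < c then (N : ℝ) / x * G 0 else 0 := by
  obtain ⟨hc1a, hc1b⟩ := abs_lt.mp hc1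
  have hsplit : ∀ s : Finset ℤ, ∑ z ∈ s, ((z : ℝ) / x - ρ) * G z =
      ∑ z ∈ s, (z : ℝ) / x * G z - ρ * ∑ z ∈ s, G z := fun s => by
    rw [Finset.mul_sum, ← Finset.sum_sub_distrib]
    exact Finset.sum_congr rfl fun z _ => by ring
  rcases lt_or_gt_of_ne hc0 with hneg | hpos
  · have hf : ⌊c⌋ = -1 := by
      rw [Int.floor_eq_iff]; push_cast; constructor <;> linarith
    rw [hf, if_neg (not_lt.mpr hneg.le), add_zero]
    have e : Finset.Ioc (-1 : ℤ) (-1 + N) = Finset.Ico 0 N := by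
      ext z; simp only [Finset.mem_Ioc, Finset.mem_Ico]; omega
    rw [e, hsplit]
  · have hf : ⌊c⌋ = 0 := by
      rw [Int.floor_eq_iff]; push_cast; constructor <;> linarith
    rw [hf, zero_add, if_pos hpos]
    have h1 : ∑ z ∈ Finset.Icc (0 : ℤ) N, ((z : ℝ) / x - ρ) * G z =
        (((0 : ℤ) : ℝ) / x - ρ) * G 0 + ∑ z ∈ Finset.Ioc (0 : ℤ) N, ((z : ℝ) / x - ρ) * G z := by
      rw [← Finset.Ioc_insert_left hN, Finset.sum_insert (by simp)]
    have h2 : ∑ z ∈ Finset.Icc (0 : ℤ) N, ((z : ℝ) / x - ρ) * G z =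
        ((N : ℝ) / x - ρ) * G N + ∑ z ∈ Finset.Ico (0 : ℤ) N, ((z : ℝ) / x - ρ) * G z := by
      rw [← Finset.Ico_insert_right hN, Finset.sum_insert (by simp)]
    have h3 : ∑ z ∈ Finset.Ioc (0 : ℤ) N, ((z : ℝ) / x - ρ) * G z =
        ∑ z ∈ Finset.Ico (0 : ℤ) N, ((z : ℝ) / x - ρ) * G z + (N : ℝ) / x * G 0 := by
      rw [hG, sub_mul] at h2
      push_cast at h1
      rw [zero_div, zero_sub, neg_mul] at h1
      linarith
    rw [h3, hsplit]

/-- **At a junction of which `k` is NOT a member the canonical marginal of `k` vanishes** (for a reference with pairwise distinct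
rates): the weak and the strict upper rate sets of `k` contain the same members. -/
theorem patternN_marginal_eq_zero_of_nonmember {a : Dir} {b : ℝ} {δ : Fin 8 → ℝ}
    (hgen : ∀ k l : Fin 28, k ≠ l → phiForm δ k / h28 a k ≠ phiForm δ l / h28 a l) {k : Fin 28}
    (hnon : ∀ z : ℤ, b * h28 a k ≠ z) :
    patternN a b (Finset.univ.filter fun l => phiForm δ k / h28 a k ≤ phiForm δ l / h28 a l) =
      patternN a b (Finset.univ.filter fun l => phiForm δ k / h28 a k < phiForm δ l / h28 a l) := by
  refine patternN_congr fun l hl => ?_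
  have hlk : l ≠ k := by rintro rfl; obtain ⟨z, hz⟩ := hl; exact hnon z hz
  simp only [Finset.mem_filter, Finset.mem_univ, true_and]
  have hne := hgen k l (Ne.symm hlk)
  exact ⟨fun h => lt_of_le_of_ne h hne, le_of_lt⟩

/-! ### The first moments on the coherent chamber -/

/-- **THE FIRST MOMENTS ON THE COHERENT CHAMBER.** All 28 forms of `a` positive, `T > 0` a period, `F` the canonical period pattern
function; `δ` with a margin `r` (`hsep`, `hend`) and coherent (`|ρ_k| ≤ ρ̄`, `(2ρ̄ + r/2)·x_max < 1` and `< wallDist a T`). Then for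
EVERY form `k` the first moment of P2 g40's tilt theorem is
`m_k(δ) = Σ_{m<#bkpts−1} b_m·g_k(b_m) − ρ_k·(F(P≤(k)) − F(P<(k))) + [0 < φ_kδ]·T·g_k(0)`,
`g_k(b) = patternN a b (P≤(k)) − patternN a b (P<(k))`, `P≤(k) = {l : ρ_k ≤ ρ_l}`, `P<(k) = {l : ρ_k < ρ_l}` — chamber data of the
CLOSED orbit: the junction first moment `M_k`, the chamber weight `W_k`, the lattice-junction marginal `g_k(0)`. -/
theorem firstMoment_eq_canonical {a : Dir} (hpos : ∀ k, 0 < h28 a k) {T : ℝ} (hT : 0 < T)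
    (hper : ∀ k : Fin 28, ∃ z : ℤ, T * h28 a k = z) {F : Finset (Fin 28) → ℝ}
    (hF : ∀ A, F A = ∑ m ∈ Finset.range ((bkpts a T).card - 1), ((patternN a (bkpt a T m) A : ℤ) : ℝ))
    {δ : Fin 8 → ℝ} {r : ℝ} (hr : 0 < r)
    (hsep : ∀ (k k' : Fin 28) (z z' : ℤ), (k ≠ k' ∨ z ≠ z') →
      r ≤ |((z : ℝ) - phiForm δ k) / h28 a k - ((z' : ℝ) - phiForm δ k') / h28 a k'|)
    (hend : ∀ (k : Fin 28) (z : ℤ), r ≤ |((z : ℝ) - phiForm δ k) / h28 a k|)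
    {ρb : ℝ} (hρ : ∀ k, |phiForm δ k / h28 a k| ≤ ρb) (hc1 : (2 * ρb + r / 2) * xMax a < 1)
    (hc2 : (2 * ρb + r / 2) * xMax a < wallDist a T) (k : Fin 28) :
    ∑ z ∈ Finset.Ioc ⌊phiForm δ k⌋ (⌊phiForm δ k⌋ + ⌊T * h28 a k⌋),
        ((z : ℝ) - phiForm δ k) / h28 a k *
          ((torusN ((((z : ℝ) - phiForm δ k) / h28 a k) • sParam a + δ) -
            torusN ((((z : ℝ) - phiForm δ k) / h28 a k - r / 2) • sParam a + δ) : ℤ) : ℝ) =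
      ∑ m ∈ Finset.range ((bkpts a T).card - 1), bkpt a T m *
          (((patternN a (bkpt a T m)
              (Finset.univ.filter fun l => phiForm δ k / h28 a k ≤ phiForm δ l / h28 a l) : ℤ) : ℝ) -
            ((patternN a (bkpt a T m)
              (Finset.univ.filter fun l => phiForm δ k / h28 a k < phiForm δ l / h28 a l) : ℤ) : ℝ)) -
        phiForm δ k / h28 a k *
          (F (Finset.univ.filter fun l => phiForm δ k / h28 a k ≤ phiForm δ l / h28 a l) -
            F (Finset.univ.filter fun l => phiForm δ k / h28 a k < phiForm δ l / h28 a l)) +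
        if 0 < phiForm δ k then
          T * (((patternN a 0 (Finset.univ.filter fun l => phiForm δ k / h28 a k ≤ phiForm δ l / h28 a l) : ℤ) : ℝ) -
            ((patternN a 0 (Finset.univ.filter fun l => phiForm δ k / h28 a k < phiForm δ l / h28 a l) : ℤ) : ℝ))
        else 0 := by
  classical
  have hk := hpos k
  have hx : 0 < xMax a := xMax_pos hpos
  obtain ⟨N, hN⟩ := hper k
  have hNf : ⌊T * h28 a k⌋ = N := by rw [hN, Int.floor_intCast]
  have hN0 : 0 ≤ N := by
    have : (0 : ℝ) ≤ N := by rw [← hN]; exact (mul_pos hT hk).le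
    exact_mod_cast this
  set A : Finset (Fin 28) := Finset.univ.filter fun l => phiForm δ k / h28 a k ≤ phiForm δ l / h28 a l with hA
  set B : Finset (Fin 28) := Finset.univ.filter fun l => phiForm δ k / h28 a k < phiForm δ l / h28 a l with hB
  -- `|φ_k δ| < 1`, `φ_k δ ≠ 0`
  have hρk : |phiForm δ k| < 1 := by
    have h1 : |phiForm δ k| = h28 a k * |phiForm δ k / h28 a k| := by
      rw [abs_div, abs_of_pos hk]; field_simp
    rw [h1]
    have h4 : 0 ≤ ρb := (abs_nonneg _).trans (hρ k)
    calc h28 a k * |phiForm δ k / h28 a k| ≤ xMax a * ρb := mul_le_mul (le_xMax a k) (hρ k) (abs_nonneg _) hx.le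
      _ < 1 := by nlinarith
  have hρk0 : phiForm δ k ≠ 0 := by
    intro h
    have h' := rate_abs_of_margin hend k
    rw [h, zero_div, abs_zero] at h'
    exact absurd h' (not_le.mpr hr)
  -- the marginal as a function of the height, and as a function of the integer `z`
  set g : ℝ → ℝ := fun b => ((patternN a b A : ℤ) : ℝ) - ((patternN a b B : ℤ) : ℝ) with hg
  -- step 1: termwise, jumps are marginals and crossing times are `z/h_k − ρ_k`
  have step1 : ∑ z ∈ Finset.Ioc ⌊phiForm δ k⌋ (⌊phiForm δ k⌋ + ⌊T * h28 a k⌋),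
      ((z : ℝ) - phiForm δ k) / h28 a k *
        ((torusN ((((z : ℝ) - phiForm δ k) / h28 a k) • sParam a + δ) -
          torusN ((((z : ℝ) - phiForm δ k) / h28 a k - r / 2) • sParam a + δ) : ℤ) : ℝ) =
      ∑ z ∈ Finset.Ioc ⌊phiForm δ k⌋ (⌊phiForm δ k⌋ + N),
        ((z : ℝ) / h28 a k - phiForm δ k / h28 a k) * g ((z : ℝ) / h28 a k) := by
    rw [hNf]
    refine Finset.sum_congr rfl fun z hz => ?_
    rw [Finset.mem_Ioc] at hz
    have hfl : -1 ≤ ⌊phiForm δ k⌋ := by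
      have : (-1 : ℝ) < phiForm δ k := by linarith [(abs_lt.mp hρk).1]
      have h := Int.floor_le_floor this.le
      rw [show ((-1 : ℝ)) = ((-1 : ℤ) : ℝ) by norm_num, Int.floor_intCast] at h
      exact h
    have hfu : ⌊phiForm δ k⌋ ≤ 0 := by
      have h' : ⌊phiForm δ k⌋ < 1 := Int.floor_lt.mpr (by push_cast; exact (abs_lt.mp hρk).2)
      omega
    have hz0 : 0 ≤ z := by omega
    have hzT : (z : ℝ) / h28 a k ≤ T := by
      rw [div_le_iff₀ hk, hN]; exact_mod_cast (show z ≤ N by omega)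
    rw [jump_eq_patternN_marginal hpos hr hsep hρ hc1 hc2 k hz0 hzT, hg, sub_div]
    push_cast
    ring
  -- step 2: the weighted window
  have hGper : g ((N : ℤ) / h28 a k) = g ((0 : ℤ) / h28 a k) := by
    have eT : ((N : ℤ) : ℝ) / h28 a k = 0 + T := by rw [← hN, zero_add, mul_div_cancel_right₀ _ hk.ne']
    have e0 : (((0 : ℤ) : ℝ)) / h28 a k = 0 := by simp
    simp only [hg, eT, e0, patternN_add_period a hper]
  have step2 := sum_Ioc_floor_weighted_eq hρk hρk0 hN0 (h28 a k) (phiForm δ k / h28 a k)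
    (fun z : ℤ => g ((z : ℝ) / h28 a k)) hGper
  -- step 3: the standard window sums are the junction sums
  have hvan : ∀ m, m < (bkpts a T).card - 1 → (∀ z : ℤ, bkpt a T m * h28 a k ≠ z) → g (bkpt a T m) = 0 := by
    intro m _ hnon
    rw [hg]; dsimp only
    rw [sub_eq_zero, Int.cast_inj, hA, hB]
    exact patternN_marginal_eq_zero_of_nonmember (rate_ne_of_margin hr hsep) hnon
  have step3a : ∑ z ∈ Finset.Ico (0 : ℤ) N, g ((z : ℝ) / h28 a k) = F A - F B := by
    rw [hF A, hF B, ← Finset.sum_sub_distrib, sum_range_bkpt_eq_sum_filter_member k (g := g) hvan,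
      sum_member_junctions_eq_sum_Ico hpos hT k hN g]
  have step3b : ∑ z ∈ Finset.Ico (0 : ℤ) N, (z : ℝ) / h28 a k * g ((z : ℝ) / h28 a k) =
      ∑ m ∈ Finset.range ((bkpts a T).card - 1), bkpt a T m * g (bkpt a T m) := by
    rw [sum_range_bkpt_eq_sum_filter_member k (g := fun b => b * g b)
      (fun m hm hnon => by rw [hvan m hm hnon, mul_zero]),
      sum_member_junctions_eq_sum_Ico hpos hT k hN (fun b => b * g b)]
  have e0 : g ((((0 : ℤ) : ℝ)) / h28 a k) = g 0 := by simp
  rw [step1, step2, step3a, step3b, e0, ← hN, mul_div_cancel_right₀ _ hk.ne']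

/-- **THE DRIFT'S CLOSED-ORBIT LIMIT.** Under the same hypotheses, for every tilt `η` of the direction with `T·|φ_kη| ≤ r·h_k(a)/4`:
`∫₀ᵀ[𝒩(u·(s(a)+η)+δ) − 𝒩(u·s(a)+δ)]du = Σ_k (φ_kη/(h_k+φ_kη))·(M_k − ρ_k·W_k + [0 < φ_kδ]·T·g_k(0))` — P2 g40's tilt theorem with the
first moments replaced by the closed orbit's chamber data: the within-period drift of SE-DESK-NOTE §3(ii) at a coherent translate,
term by term. -/
theorem integral_tilt_sub_eq_canonical {a : Dir} (hpos : ∀ k, 0 < h28 a k) {T : ℝ} (hT : 0 < T)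
    (hper : ∀ k : Fin 28, ∃ z : ℤ, T * h28 a k = z) {F : Finset (Fin 28) → ℝ}
    (hF : ∀ A, F A = ∑ m ∈ Finset.range ((bkpts a T).card - 1), ((patternN a (bkpt a T m) A : ℤ) : ℝ))
    {δ : Fin 8 → ℝ} {r : ℝ} (hr : 0 < r)
    (hsep : ∀ (k k' : Fin 28) (z z' : ℤ), (k ≠ k' ∨ z ≠ z') →
      r ≤ |((z : ℝ) - phiForm δ k) / h28 a k - ((z' : ℝ) - phiForm δ k') / h28 a k'|)
    (hend : ∀ (k : Fin 28) (z : ℤ), r ≤ |((z : ℝ) - phiForm δ k) / h28 a k|)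
    {ρb : ℝ} (hρ : ∀ k, |phiForm δ k / h28 a k| ≤ ρb) (hc1 : (2 * ρb + r / 2) * xMax a < 1)
    (hc2 : (2 * ρb + r / 2) * xMax a < wallDist a T)
    {η : Fin 8 → ℝ} (hη : ∀ k, T * |phiForm η k| ≤ r * h28 a k / 4) :
    ∫ u in (0 : ℝ)..T, ((torusN (u • (sParam a + η) + δ) : ℝ) - torusN (u • sParam a + δ)) =
      ∑ k : Fin 28, phiForm η k / (h28 a k + phiForm η k) *
        (∑ m ∈ Finset.range ((bkpts a T).card - 1), bkpt a T m *
            (((patternN a (bkpt a T m)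
                (Finset.univ.filter fun l => phiForm δ k / h28 a k ≤ phiForm δ l / h28 a l) : ℤ) : ℝ) -
              ((patternN a (bkpt a T m)
                (Finset.univ.filter fun l => phiForm δ k / h28 a k < phiForm δ l / h28 a l) : ℤ) : ℝ)) -
          phiForm δ k / h28 a k *
            (F (Finset.univ.filter fun l => phiForm δ k / h28 a k ≤ phiForm δ l / h28 a l) -
              F (Finset.univ.filter fun l => phiForm δ k / h28 a k < phiForm δ l / h28 a l)) +
          if 0 < phiForm δ k then
            T * (((patternN a 0 (Finset.univ.filter fun l => phiForm δ k / h28 a k ≤ phiForm δ l / h28 a l) : ℤ) : ℝ) -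
              ((patternN a 0 (Finset.univ.filter fun l => phiForm δ k / h28 a k < phiForm δ l / h28 a l) : ℤ) : ℝ))
          else 0) := by
  rw [integral_tilt_sub_eq_sum_firstMoment hpos hT hper hr hsep hend hη]
  refine Finset.sum_congr rfl fun k _ => ?_
  rw [firstMoment_eq_canonical hpos hT hper hF hr hsep hend hρ hc1 hc2 k]

/-! ### Margin-free packaging: the closed-orbit dictionary at a coherent generic translate -/

/-- **THE CLOSED-ORBIT DICTIONARY, margin-free.** All 28 forms of `a` positive, `T > 0` a period, `F` the canonical period pattern
function; `δ` with pairwise distinct non-zero rates, `|ρ_k| ≤ ρ̄`, `3ρ̄·x_max < 1`, `3ρ̄·x_max < wallDist a T`, `2T·x_max²·ρ̄ < 1`. Then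
there is a margin `r` (`0 < r ≤ 2ρ̄`, with `hsep` ∧ `hend`) for which, for EVERY form `k`, P2 g40's per-period signed jump mass IS the
chamber weight, `J_k(δ) = F(P≤(k)) − F(P<(k))`, AND the first moment is `m_k(δ) = M_k − ρ_k·W_k + [0 < φ_kδ]·T·g_k(0)` (files (2), (3)
with the margin of `exists_margin_of_coherent`). -/
theorem jumpMass_firstMoment_eq_canonical_of_coherent {a : Dir} (hpos : ∀ k, 0 < h28 a k) {T : ℝ} (hT : 0 < T)
    (hper : ∀ k : Fin 28, ∃ z : ℤ, T * h28 a k = z) {F : Finset (Fin 28) → ℝ}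
    (hF : ∀ A, F A = ∑ m ∈ Finset.range ((bkpts a T).card - 1), ((patternN a (bkpt a T m) A : ℤ) : ℝ))
    {δ : Fin 8 → ℝ} (hgen : ∀ k l : Fin 28, k ≠ l → phiForm δ k / h28 a k ≠ phiForm δ l / h28 a l)
    (hnz : ∀ k, phiForm δ k ≠ 0) {ρb : ℝ} (hρ : ∀ k, |phiForm δ k / h28 a k| ≤ ρb) (hc1 : 3 * ρb * xMax a < 1)
    (hc2 : 3 * ρb * xMax a < wallDist a T) (hc3 : 2 * T * xMax a ^ 2 * ρb < 1) :
    ∃ r : ℝ, 0 < r ∧ r ≤ 2 * ρb ∧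
      (∀ (k k' : Fin 28) (z z' : ℤ), (k ≠ k' ∨ z ≠ z') →
        r ≤ |((z : ℝ) - phiForm δ k) / h28 a k - ((z' : ℝ) - phiForm δ k') / h28 a k'|) ∧
      (∀ (k : Fin 28) (z : ℤ), r ≤ |((z : ℝ) - phiForm δ k) / h28 a k|) ∧
      ∀ k : Fin 28,
        ((∑ z ∈ Finset.Ioc ⌊phiForm δ k⌋ (⌊phiForm δ k⌋ + ⌊T * h28 a k⌋),
            (torusN ((((z : ℝ) - phiForm δ k) / h28 a k) • sParam a + δ) -
              torusN ((((z : ℝ) - phiForm δ k) / h28 a k - r / 2) • sParam a + δ)) : ℤ) : ℝ) =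
          F (Finset.univ.filter fun l => phiForm δ k / h28 a k ≤ phiForm δ l / h28 a l) -
            F (Finset.univ.filter fun l => phiForm δ k / h28 a k < phiForm δ l / h28 a l) ∧
        ∑ z ∈ Finset.Ioc ⌊phiForm δ k⌋ (⌊phiForm δ k⌋ + ⌊T * h28 a k⌋),
            ((z : ℝ) - phiForm δ k) / h28 a k *
              ((torusN ((((z : ℝ) - phiForm δ k) / h28 a k) • sParam a + δ) -
                torusN ((((z : ℝ) - phiForm δ k) / h28 a k - r / 2) • sParam a + δ) : ℤ) : ℝ) =
          ∑ m ∈ Finset.range ((bkpts a T).card - 1), bkpt a T m *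
              (((patternN a (bkpt a T m)
                  (Finset.univ.filter fun l => phiForm δ k / h28 a k ≤ phiForm δ l / h28 a l) : ℤ) : ℝ) -
                ((patternN a (bkpt a T m)
                  (Finset.univ.filter fun l => phiForm δ k / h28 a k < phiForm δ l / h28 a l) : ℤ) : ℝ)) -
            phiForm δ k / h28 a k *
              (F (Finset.univ.filter fun l => phiForm δ k / h28 a k ≤ phiForm δ l / h28 a l) -
                F (Finset.univ.filter fun l => phiForm δ k / h28 a k < phiForm δ l / h28 a l)) +
            if 0 < phiForm δ k then
              T * (((patternN a 0
                  (Finset.univ.filter fun l => phiForm δ k / h28 a k ≤ phiForm δ l / h28 a l) : ℤ) : ℝ) -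
                ((patternN a 0
                  (Finset.univ.filter fun l => phiForm δ k / h28 a k < phiForm δ l / h28 a l) : ℤ) : ℝ))
            else 0 := by
  have hx : 0 < xMax a := xMax_pos hpos
  have hρb : 0 ≤ ρb := (abs_nonneg _).trans (hρ 0)
  obtain ⟨r, hr, hr2, hsep, hend⟩ :=
    exists_margin_of_coherent hpos hT hper hgen hnz hρ (by nlinarith) hc3
  have hc : (2 * ρb + r / 2) * xMax a ≤ 3 * ρb * xMax a := by nlinarith
  exact ⟨r, hr, hr2, hsep, hend, fun k =>
    ⟨jumpMass_eq_canonical_weight hpos hT hper hF hr hsep hend hρ (hc.trans_lt hc1) (hc.trans_lt hc2) k,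
      firstMoment_eq_canonical hpos hT hper hF hr hsep hend hρ (hc.trans_lt hc1) (hc.trans_lt hc2) k⟩⟩

end Summit.KontsevichZagierPeriods.Zeta5Search.Barrier.ConeGamma

end
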